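import Literature.Analysis.FluidPDE.HelmholtzAnnihilator
import Literature.Analysis.FluidPDE.HarmonicProbe
import Literature.Analysis.FunctionSpaces.BMOCarlesonProofs
import HarnessLib

/-!
# Liouville in `BMO⁻¹`: a weakly harmonic divergence of a `BMO` field vanishes, and the annihilator lemma in `BMO⁻¹`

Analysis/FluidPDE support file (all results proved) for the named fact (T4)
`Literature.Analysis.FluidPDE.integral_of_isKochTataruSolution` of `KochTataru.lean` (Koch–Tataru's
Theorem 2: a solution in Koch–Tataru's class solves the integral equation (11), and in
particular `v(0) = u₀` a.e.). In the tree's duality (very weak) formulation the identity at time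
`0` only says that `v(0) - u₀` pairs to zero with every *divergence-free* test field; since
`v(0)` and `u₀` are weakly divergence free and lie in `BMO⁻¹`, one needs:

* `Literature.Analysis.FunctionSpaces.HasWeakDivergenceRepresentation.ae_eq_zero_of_weaklyHarmonic`
  (**Liouville in `BMO⁻¹`**): if `w = div Φ` weakly (`HasWeakDivergenceRepresentation w Φ`) with
  all components of `Φ` in `BMO`, and `w` is weakly harmonic (`∫ Δθ · w = 0` for `θ ∈ C_c^∞`), then
  `w = 0` a.e.;
* `Literature.Analysis.FluidPDE.IsWeaklyDivFree.ae_eq_zero_of_memBMOInvVec_of_forall_integral_inner_eq_zero`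
  (**annihilator lemma in `BMO⁻¹`**): a field `h ∈ BMO⁻¹(E; E)` (`MemBMOInvVec`) which is weakly
  divergence free and annihilates every smooth compactly supported divergence-free field is `0`
  a.e. — the `BMO⁻¹` counterpart of the `L^p` and `L^∞` annihilator lemmas of
  `HelmholtzAnnihilator.lean` / `BoundedAnnihilator.lean` (there the conclusion for bounded fields
  is "constant"; constants are *not* weak divergences of `BMO` fields, and this is exactly what
  the `BMO⁻¹` hypothesis adds).

This is the uniqueness mechanism of Lemarié-Rieusset 2016, Def. 6.4 ("if `∇∧H = 0` and
`div H = 0`, then `ΔH = 0` … harmonic; if moreover `H` vanishes at infinity, `H = 0`", p. 130),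
with "vanishing at infinity" realised by the divergence form `BMO⁻¹ = div BMO` (Koch–Tataru 2001,
Theorem 1) instead of the heat semigroup, so that no temperedness of `h` as a function is needed.

## Proof (mean value property against a `BMO` oscillation)

As in `BoundedAnnihilator.lean` (Lemarié-Rieusset 2016, proof of Thm. 4.4, run on
mollifications): `w_k = φ_k ⋆ w` is smooth and harmonic (`laplacian_convolution_lsmul` and weak
harmonicity). For the smooth radial plateau `ρ_R(x) = ρ(x/R)`, `ρ = baseBump` of
`HarmonicProbe.lean` (`= 1` on `B(0, 1)`, `= 0` off `B(0, 2)`),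
the weighted mean value property (`integral_radial_mul_harmonic`, Gilbarg–Trudinger Thm. 2.1) and
associativity of convolution give `R^d (∫ρ) w_k(x₀) = ∫ ρ_R(x) w_k(x₀ + x) dx = ∫ w Ψ` with the test
function `Ψ = (ρ_R ⋆ φ_k)(x₀ - ·)`, whence by the weak divergence identity and `∫ ∇Ψ = 0`,
`R^d (∫ρ) w_k(x₀) = -∫ ⟪Φ - c, ∇Ψ⟫` for every constant vector `c`; now `‖∇Ψ‖ ≤ ‖∇ρ‖_∞ / R`, `Ψ` is
supported in `B(x₀, 4R)`, and choosing for `c` the ball averages of the components of `Φ`,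
`∫_{B(x₀,4R)} ‖Φ - c‖ ≤ Σᵢ ‖Φᵢ‖_* |B(x₀, 4R)| = O(R^d)` (`MemBMO.setIntegral_norm_sub_average_le`).
Hence `|w_k(x₀)| = O(1/R) → 0`, `w_k ≡ 0`, and `w = lim w_k = 0` a.e.
(`ae_tendsto_normed_convolution`). The vector lemma applies this to the components `⟪h, eᵢ⟫`,
which are weakly harmonic by `integral_laplacian_mul_inner_eq_zero` (`HelmholtzAnnihilator.lean`).

## Mathlib / tree search

Tree: `HasWeakDivergenceRepresentation`, `MemBMOInv(Vec)` (`BMO.lean`),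
`MemBMO.setIntegral_norm_sub_average_le`, `MemBMO.integrableOn_ball` (`BMOCarlesonProofs`),
`integral_radial_mul_harmonic` (`HarmonicMeanValue`), `baseBump`, `baseBumpMass_pos`,
`exists_bound_baseBump_derivs` (`HarmonicProbe`), `laplacian_convolution_lsmul`,
`fderiv_convolution_lsmul_apply`, `integral_laplacian_mul_inner_eq_zero` (`HelmholtzAnnihilator`),
`exists_contDiffBump_seq`, `ae_tendsto_normed_convolution`, `IsTestFunctionOn.comp_sub_left`
(`Mollification`), `integral_fderiv_apply_eq_zero`, `inner_gradient_eq_fderiv_apply`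
(`WholeSpaceIBP`, `WeakGradientIBP`). Mathlib: `convolution_assoc`,
`HasCompactSupport.convolution/contDiff_convolution_right/hasFDerivAt_convolution_left`,
`Measure.addHaar_ball_of_pos`, `Measure.integral_comp_inv_smul_of_nonneg`,
`Continuous.bounded_above_of_compact_support`. No Liouville/annihilator statement for `BMO⁻¹`
exists in the tree (`lean search 'BMOInv|annihilator|Liouville'`).

## References

* P. G. Lemarié-Rieusset, *The Navier–Stokes problem in the 21st century*, CRC Press 2016,
  Def. 6.4 and the uniqueness remark following it (p. 130), proof of Thm. 4.4 (pp. 56–57).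
  Bib key `LemarieRieusset2016`.
* H. Koch, D. Tataru, *Well-posedness for the Navier–Stokes equations*, Adv. Math. 157 (2001),
  Theorem 1 (`BMO⁻¹ = div BMO`). Bib key `KochTataruAdvMath2001`.
* D. Gilbarg, N. S. Trudinger, *Elliptic partial differential equations of second order*, Thm. 2.1.
  Bib key `GilbargTrudinger2001`.
-/

noncomputable section

open MeasureTheory TopologicalSpace Set Function Filter InnerProductSpace
  ContinuousLinearMap Metric
open _root_.Topology _root_.Real
open scoped RealInnerProductSpace ENNReal NNReal Convolution ContDiff Laplacian

namespace Literature.Analysis.FluidPDE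

variable {E : Type*} [NormedAddCommGroup E] [InnerProductSpace ℝ E] [FiniteDimensional ℝ E]
  [MeasurableSpace E] [BorelSpace E]

/-! ### Liouville in `BMO⁻¹` -/

section Liouville

/-- **A harmonic mollification of a weak `BMO`-divergence vanishes.** Let `w = div Φ` weakly
with all components of `Φ` in `BMO`, and let `ψ` be a nonnegative test function of mass one
such that `ψ ⋆ w` is harmonic on `E`. Then `ψ ⋆ w ≡ 0`: by the weighted mean value property
with the plateau `ρ_R`, `R^d (∫ρ) (ψ ⋆ w)(x₀) = ∫ w Ψ = -∫ ⟪Φ - c, ∇Ψ⟫` for the test function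
`Ψ = (ρ_R ⋆ ψ)(x₀ - ·)`, `‖∇Ψ‖ ≤ ‖∇ρ‖_∞/R`, `supp Ψ ⊆ B(x₀, 4R)`, and the `BMO` oscillation of the
components of `Φ` on `B(x₀, 4R)` is `O(R^d)` (Lemarié-Rieusset 2016, remark after Def. 6.4;
proof pattern of Thm. 4.4). [cite: LemarieRieusset2016, Def. 6.4 and the uniqueness remark p. 130] -/
theorem convolution_eq_zero_of_harmonic_of_hasWeakDivergenceRepresentation
    {w : E → ℝ} {Φ : E → E} (hrep : FunctionSpaces.HasWeakDivergenceRepresentation w Φ)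
    (hΦ : ∀ v : E, FunctionSpaces.MemBMO (fun x => ⟪Φ x, v⟫))
    {ψ : E → ℝ} (hψ : FunctionSpaces.IsTestFunctionOn (⊤ : Opens E) ψ) (hψ0 : ∀ x, 0 ≤ ψ x)
    (hψ1 : ∫ x, ψ x = 1) (hharm : HarmonicOnNhd (ψ ⋆[lsmul ℝ ℝ, volume] w) univ) (x₀ : E) :
    (ψ ⋆[lsmul ℝ ℝ, volume] w) x₀ = 0 := by
  haveI : CompleteSpace E := FiniteDimensional.complete ℝ E
  set e := stdOrthonormalBasis ℝ E with he
  set d : ℕ := Module.finrank ℝ E with hd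
  set η : E → ℝ := ψ ⋆[lsmul ℝ ℝ, volume] w with hη
  have hwl : LocallyIntegrable w volume := hrep.locallyIntegrable
  have hwln : LocallyIntegrable (fun x => ‖w x‖) volume :=
    hwl.mono hwl.aestronglyMeasurable.norm (Eventually.of_forall fun x => by simp)
  have hΦl : LocallyIntegrable Φ volume := hrep.locallyIntegrable_field
  have hψc := hψ.hasCompactSupport
  have hψ1' : ContDiff ℝ 1 ψ := hψ.contDiff.of_le (by exact_mod_cast le_top)
  -- support radius of `ψ`
  obtain ⟨r, hr, hrψ⟩ : ∃ r : ℝ, 0 < r ∧ tsupport ψ ⊆ ball (0 : E) r :=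
    hψc.isCompact.isBounded.subset_ball_lt 0 0
  have hψz : ∀ y : E, r ≤ ‖y‖ → ψ y = 0 := fun y hy =>
    image_eq_zero_of_notMem_tsupport fun h => by
      have := hrψ h; rw [mem_ball_zero_iff] at this; linarith
  -- the plateau `ρ = baseBump` (`HarmonicProbe.lean`), its mass and gradient bound
  obtain ⟨L, hL0, hL⟩ : ∃ L : ℝ, 0 ≤ L ∧ ∀ x : E, ‖fderiv ℝ baseBump x‖ ≤ L := by
    obtain ⟨C, hC⟩ := (exists_bound_baseBump_derivs (E := E)).1
    exact ⟨max C 0, le_max_right _ _, fun x => (hC x).trans (le_max_left _ _)⟩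
  set I : ℝ := ∫ x : E, baseBump x with hI
  have hI0 : 0 < I := baseBumpMass_pos
  -- the `BMO` size of `Φ`
  set S : ℝ := ∑ i, (FunctionSpaces.eBMOSeminorm (fun x => ⟪Φ x, e i⟫) volume).toReal with hS
  have hS0 : 0 ≤ S := Finset.sum_nonneg fun i _ => ENNReal.toReal_nonneg
  set V₁ : ℝ := (volume : Measure E).real (ball (0 : E) 1) with hV₁
  -- the main estimate: `I |η x₀| ≤ L 4^d V₁ S / R` for `R ≥ max 1 r`
  have key : ∀ R : ℝ, max 1 r ≤ R → I * |η x₀| ≤ L * 4 ^ d * V₁ * S / R := by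
    intro R hR
    have hR1 : 1 ≤ R := (le_max_left _ _).trans hR
    have hRr : r ≤ R := (le_max_right _ _).trans hR
    have hR0 : 0 < R := by linarith
    -- the scaled plateau `ρ_R`
    set ρR : E → ℝ := fun x => baseBump (R⁻¹ • x) with hρR
    have hρR1 : ContDiff ℝ 1 ρR := (contDiff_baseBump (n := 1)).comp (contDiff_const.smul contDiff_id)
    have hρRc : Continuous ρR := hρR1.continuous
    have hρRs : HasCompactSupport ρR := hasCompactSupport_baseBump.comp_smul (inv_ne_zero hR0.ne')
    have hρRrad : ∀ x y : E, ‖x‖ = ‖y‖ → ρR x = ρR y := fun x y h =>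
      baseBump_radial (by simp [norm_smul, h])
    have hρRz : ∀ x : E, 2 * R ≤ ‖x‖ → ρR x = 0 := fun x hx => by
      refine baseBump_eq_zero ?_
      rw [norm_smul, norm_inv, Real.norm_of_nonneg hR0.le, le_inv_mul_iff₀ hR0]
      linarith
    have hρReven : ∀ x : E, ρR (-x) = ρR x := fun x => hρRrad _ _ (norm_neg x)
    have hρRD : ∀ x v : E, ‖fderiv ℝ ρR x v‖ ≤ L / R * ‖v‖ := by
      intro x v
      have hsm : HasFDerivAt (fun x : E => R⁻¹ • x) (R⁻¹ • ContinuousLinearMap.id ℝ E) x :=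
        (hasFDerivAt_id x).const_smul R⁻¹
      have hcomp := ((contDiff_baseBump (n := 1)).differentiable one_ne_zero (R⁻¹ • x)).hasFDerivAt.comp x hsm
      rw [show ρR = baseBump ∘ fun x : E => R⁻¹ • x from rfl, hcomp.fderiv]
      simp only [ContinuousLinearMap.coe_comp, comp_apply, map_smul, smul_apply,
        ContinuousLinearMap.coe_id', id_eq]
      rw [norm_smul, norm_inv, Real.norm_of_nonneg hR0.le, div_eq_mul_inv, mul_comm L]
      rw [mul_assoc]
      gcongr
      exact ((fderiv ℝ baseBump (R⁻¹ • x)).le_opNorm v).trans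
        (mul_le_mul_of_nonneg_right (hL _) (norm_nonneg _))
    have hmass : ∫ x, ρR x = R ^ d * I := by
      have h := Measure.integral_comp_inv_smul_of_nonneg volume (baseBump (E := E)) hR0.le
      simpa [hρR, smul_eq_mul] using h
    -- Step 1: mean value property and the convolution `ρ_R ⋆ η`
    have hmv := integral_radial_mul_harmonic hharm hρRc hρRs hρRrad x₀
    have hconv1 : ∫ x, ρR x * η (x₀ + x) = (ρR ⋆[lsmul ℝ ℝ, volume] η) x₀ := by
      rw [convolution_def]
      simp only [lsmul_apply, smul_eq_mul]
      rw [← integral_neg_eq_self]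
      refine integral_congr_ae (Eventually.of_forall fun x => ?_)
      dsimp only
      rw [hρReven, ← sub_eq_add_neg]
    -- Step 2: associativity `ρ_R ⋆ (ψ ⋆ w) = (ρ_R ⋆ ψ) ⋆ w`
    have hassoc : (ρR ⋆[lsmul ℝ ℝ, volume] η) x₀ = ((ρR ⋆[lsmul ℝ ℝ, volume] ψ) ⋆[lsmul ℝ ℝ, volume] w) x₀ := by
      rw [hη]
      symm
      refine convolution_assoc (lsmul ℝ ℝ) (lsmul ℝ ℝ) (lsmul ℝ ℝ) (lsmul ℝ ℝ) (fun a b c => mul_assoc a b c)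
        hρRc.aestronglyMeasurable hψ.contDiff.continuous.aestronglyMeasurable hwl.aestronglyMeasurable
        ?_ ?_ ?_
      · exact Eventually.of_forall fun y =>
          hρRs.convolutionExists_left (lsmul ℝ ℝ) hρRc hψ.contDiff.continuous.locallyIntegrable y
      · exact Eventually.of_forall fun y =>
          (hψc.norm.convolutionExists_left (mul ℝ ℝ) hψ.contDiff.continuous.norm hwln y)
      · have hcont : Continuous ((fun x => ‖ψ x‖) ⋆[mul ℝ ℝ, volume] fun x => ‖w x‖) :=
          hψc.norm.continuous_convolution_left (mul ℝ ℝ) hψ.contDiff.continuous.norm hwln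
        exact hρRs.norm.convolutionExists_left (mul ℝ ℝ) hρRc.norm hcont.locallyIntegrable x₀
    -- the test function `Ψ z = (ρ_R ⋆ ψ)(x₀ - z)`
    set Ψ₀ : E → ℝ := ρR ⋆[lsmul ℝ ℝ, volume] ψ with hΨ₀
    have hΨ₀t : FunctionSpaces.IsTestFunctionOn (⊤ : Opens E) Ψ₀ :=
      ⟨hψc.contDiff_convolution_right (lsmul ℝ ℝ) hρRc.locallyIntegrable hψ.contDiff,
        hρRs.convolution (lsmul ℝ ℝ) hψc, by simp⟩
    set Ψ : E → ℝ := fun z => Ψ₀ (x₀ - z) with hΨ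
    have hΨt : FunctionSpaces.IsTestFunctionOn (⊤ : Opens E) Ψ := hΨ₀t.comp_sub_left x₀
    have hconv2 : ((ρR ⋆[lsmul ℝ ℝ, volume] ψ) ⋆[lsmul ℝ ℝ, volume] w) x₀ = ∫ z, w z * Ψ z := by
      rw [convolution_def]
      simp only [lsmul_apply, smul_eq_mul]
      rw [← integral_sub_left_eq_self _ volume x₀]
      refine integral_congr_ae (Eventually.of_forall fun z => ?_)
      dsimp only
      rw [sub_sub_cancel, mul_comm]
    -- Step 3: the weak divergence identity and `∫ ∇Ψ = 0`
    have hdiv := hrep.integral_mul_eq Ψ hΨt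
    -- gradient bound and support of `Ψ`
    have hΨ₀D : ∀ y v : E, ‖fderiv ℝ Ψ₀ y v‖ ≤ L / R * ‖v‖ := by
      intro y v
      rw [hΨ₀, fderiv_convolution_lsmul_apply hρR1 hρRs hψ.contDiff.continuous.locallyIntegrable y v,
        convolution_def]
      simp only [lsmul_apply, smul_eq_mul]
      have hi : Integrable (fun t => L / R * ‖v‖ * ψ (y - t)) (volume : Measure E) := by
        have hψi : Integrable ψ (volume : Measure E) :=
          hψ.contDiff.continuous.integrable_of_hasCompactSupport hψc
        exact (hψi.comp_sub_left y).const_mul _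
      calc ‖∫ t, fderiv ℝ ρR t v * ψ (y - t)‖ ≤ ∫ t, ‖fderiv ℝ ρR t v * ψ (y - t)‖ :=
            norm_integral_le_integral_norm _
        _ ≤ ∫ t, L / R * ‖v‖ * ψ (y - t) := by
            refine integral_mono_of_nonneg (Eventually.of_forall fun t => norm_nonneg _) hi
              (Eventually.of_forall fun t => ?_)
            dsimp only
            rw [norm_mul, Real.norm_of_nonneg (hψ0 _)]
            exact mul_le_mul_of_nonneg_right (hρRD t v) (hψ0 _)
        _ = L / R * ‖v‖ := by
            rw [integral_const_mul, integral_sub_left_eq_self ψ volume y, hψ1, mul_one]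
    have hΨD : ∀ z : E, ‖gradient Ψ z‖ ≤ L / R := by
      intro z
      have h1 : ContDiff ℝ 1 Ψ₀ := hΨ₀t.contDiff.of_le (by exact_mod_cast le_top)
      rw [gradient, LinearIsometryEquiv.norm_map]
      refine ContinuousLinearMap.opNorm_le_bound _ (by positivity) fun v => ?_
      rw [hΨ, FunctionSpaces.fderiv_comp_sub_left_apply h1 x₀ z v, norm_neg]
      exact hΨ₀D _ v
    have hΨsupp : ∀ z : E, z ∉ ball x₀ (4 * R) → gradient Ψ z = 0 := by
      intro z hz
      refine gradient_eq_zero_of_notMem_tsupport fun hz' => hz ?_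
      -- `tsupport Ψ ⊆ B̄(x₀, 2R + r) ⊆ B(x₀, 4R)`: `Ψ₀` vanishes off `B(0, 2R + r)`
      have hΨ₀z : ∀ y : E, 2 * R + r ≤ ‖y‖ → Ψ₀ y = 0 := by
        intro y hy
        rw [hΨ₀, convolution_def]
        refine integral_eq_zero_of_ae (Eventually.of_forall fun t => ?_)
        simp only [lsmul_apply, smul_eq_mul, Pi.zero_apply]
        by_cases ht : ‖t‖ < 2 * R
        · rw [hψz _ ?_, mul_zero]
          have := norm_sub_norm_le y t
          linarith
        · rw [hρRz t (not_lt.1 ht), zero_mul]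
      have hsub : tsupport Ψ ⊆ closedBall x₀ (2 * R + r) := by
        refine closure_minimal (fun z hz => ?_) isClosed_closedBall
        rw [mem_closedBall, dist_eq_norm']
        by_contra h
        exact hz (hΨ₀z _ (not_le.1 h).le)
      have := hsub hz'
      rw [mem_closedBall, dist_eq_norm'] at this
      rw [mem_ball, dist_eq_norm']
      linarith
    -- Step 4: the componentwise `BMO` estimate of `∫ ⟪Φ, ∇Ψ⟫`
    have hgc : Continuous (gradient Ψ) := continuous_gradient_of_contDiff
      (hΨt.contDiff.of_le (by exact_mod_cast le_top))
    have hgs : HasCompactSupport (gradient Ψ) :=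
      HasCompactSupport.intro (isCompact_closedBall x₀ (4 * R)) fun z hz =>
        hΨsupp z fun h => hz (ball_subset_closedBall h)
    have hcomp : ∀ i, |∫ z, ⟪Φ z, e i⟫ * ⟪e i, gradient Ψ z⟫| ≤
        L / R * ((FunctionSpaces.eBMOSeminorm (fun x => ⟪Φ x, e i⟫) volume).toReal *
          (volume : Measure E).real (ball x₀ (4 * R))) := by
      intro i
      set f : E → ℝ := fun x => ⟪Φ x, e i⟫ with hf
      set m : ℝ := ⨍ z in ball x₀ (4 * R), f z with hm
      have hfB := hΦ (e i)
      -- `∫ m ⟪eᵢ, ∇Ψ⟫ = 0`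
      have hzero : ∫ z, m * ⟪e i, gradient Ψ z⟫ = 0 := by
        rw [integral_const_mul]
        simp_rw [inner_gradient_eq_fderiv_apply]
        rw [integral_fderiv_apply_eq_zero (hΨt.contDiff.of_le (by exact_mod_cast le_top))
          hΨt.hasCompactSupport (e i), mul_zero]
      have hgi : ∀ g : E → ℝ, LocallyIntegrable g volume →
          Integrable (fun z => g z * ⟪e i, gradient Ψ z⟫) := fun g hg => by
        have := hg.integrable_smul_right_of_hasCompactSupport
          (continuous_const.inner hgc : Continuous fun z => ⟪e i, gradient Ψ z⟫) ?_
        · simpa [smul_eq_mul] using this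
        · exact hgs.mono' fun z hz => by
            refine subset_tsupport _ ?_
            intro h0; exact hz (by simp [h0])
      have hfl : LocallyIntegrable f volume := hfB.1
      have hsplit : ∫ z, f z * ⟪e i, gradient Ψ z⟫ = ∫ z, (f z - m) * ⟪e i, gradient Ψ z⟫ := by
        have h := integral_sub (hgi f hfl) (hgi (fun _ => m) (locallyIntegrable_const m))
        rw [hzero, sub_zero] at h
        rw [← h]
        refine integral_congr_ae (Eventually.of_forall fun z => ?_)
        ring
      rw [hsplit, ← setIntegral_eq_integral_of_forall_compl_eq_zero (s := ball x₀ (4 * R))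
        (fun z hz => by rw [hΨsupp z hz, inner_zero_right, mul_zero])]
      calc |∫ z in ball x₀ (4 * R), (f z - m) * ⟪e i, gradient Ψ z⟫|
          ≤ ∫ z in ball x₀ (4 * R), |(f z - m) * ⟪e i, gradient Ψ z⟫| := abs_integral_le_integral_abs
        _ ≤ ∫ z in ball x₀ (4 * R), ‖f z - m‖ * (L / R) := by
            refine integral_mono_of_nonneg (Eventually.of_forall fun z => abs_nonneg _)
              (((hfB.integrableOn_ball x₀ (4 * R)).sub (integrableOn_const
                measure_ball_lt_top.ne enorm_ne_top)).norm.mul_const _)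
              (Eventually.of_forall fun z => ?_)
            dsimp only
            rw [abs_mul, Real.norm_eq_abs]
            gcongr
            calc |⟪e i, gradient Ψ z⟫| ≤ ‖e i‖ * ‖gradient Ψ z‖ := abs_real_inner_le_norm _ _
              _ ≤ 1 * (L / R) := by
                  gcongr
                  · rw [e.orthonormal.1 i]
                  · exact hΨD z
              _ = L / R := one_mul _
        _ = (∫ z in ball x₀ (4 * R), ‖f z - m‖) * (L / R) := integral_mul_const _ _
        _ ≤ ((FunctionSpaces.eBMOSeminorm f volume).toReal * (volume : Measure E).real (ball x₀ (4 * R))) *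
              (L / R) := by
            gcongr
            exact hfB.setIntegral_norm_sub_average_le x₀ (by positivity)
        _ = _ := by ring
    have hvol : (volume : Measure E).real (ball x₀ (4 * R)) = (4 * R) ^ d * V₁ := by
      rw [measureReal_def, Measure.addHaar_ball_of_pos _ x₀ (by positivity : (0:ℝ) < 4 * R),
        ENNReal.toReal_mul, ENNReal.toReal_ofReal (by positivity), hV₁, measureReal_def]
    -- `∫ ⟪Φ, ∇Ψ⟫ = Σᵢ ∫ ⟪Φ, eᵢ⟫⟪eᵢ, ∇Ψ⟫`
    have hsum : ∫ z, ⟪Φ z, gradient Ψ z⟫ = ∑ i, ∫ z, ⟪Φ z, e i⟫ * ⟪e i, gradient Ψ z⟫ := by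
      rw [← integral_finsetSum _ (fun i _ => ?_)]
      · refine integral_congr_ae (Eventually.of_forall fun z => ?_)
        exact (e.sum_inner_mul_inner (Φ z) (gradient Ψ z)).symm
      · have hl : LocallyIntegrable (fun x => ⟪Φ x, e i⟫) volume := (hΦ (e i)).1
        have := hl.integrable_smul_right_of_hasCompactSupport
          (continuous_const.inner hgc : Continuous fun z => ⟪e i, gradient Ψ z⟫) ?_
        · simpa [smul_eq_mul] using this
        · exact hgs.mono' fun z hz => by
            refine subset_tsupport _ ?_
            intro h0; exact hz (by simp [h0])
    -- assemble: `R^d I |η x₀| ≤ (L/R) S (4R)^d V₁`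
    have hmain : R ^ d * I * |η x₀| ≤ L / R * (S * ((4 * R) ^ d * V₁)) := by
      have h1 : R ^ d * I * η x₀ = ∫ z, w z * Ψ z := by
        rw [← hconv2, ← hassoc, ← hconv1, hmv, hmass]
      have h2 : |∫ z, w z * Ψ z| ≤ L / R * (S * ((4 * R) ^ d * V₁)) := by
        rw [hdiv, abs_neg, hsum]
        refine (Finset.abs_sum_le_sum_abs _ _).trans ?_
        rw [hS, Finset.sum_mul, Finset.mul_sum]
        refine Finset.sum_le_sum fun i _ => ?_
        rw [← hvol]
        exact (hcomp i).trans (le_of_eq (by ring))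
      calc R ^ d * I * |η x₀| = |R ^ d * I * η x₀| := by
            rw [abs_mul, abs_of_nonneg (mul_nonneg (pow_nonneg hR0.le _) hI0.le)]
        _ = |∫ z, w z * Ψ z| := by rw [h1]
        _ ≤ _ := h2
    -- divide by `R^d`
    have hRd : (0 : ℝ) < R ^ d := by positivity
    rw [le_div_iff₀ hR0]
    have h3 : I * |η x₀| * R * R ^ d ≤ L * 4 ^ d * V₁ * S * R ^ d := by
      have := mul_le_mul_of_nonneg_left hmain hR0.le
      calc I * |η x₀| * R * R ^ d = R * (R ^ d * I * |η x₀|) := by ring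
        _ ≤ R * (L / R * (S * ((4 * R) ^ d * V₁))) := this
        _ = L * 4 ^ d * V₁ * S * R ^ d := by
            field_simp
            ring
    exact le_of_mul_le_mul_right h3 hRd
  -- Step 5: let `R → ∞`
  have hlim : Tendsto (fun R : ℝ => L * 4 ^ d * V₁ * S / R) atTop (𝓝 0) :=
    tendsto_const_nhds.div_atTop tendsto_id
  have hle : I * |η x₀| ≤ 0 :=
    ge_of_tendsto hlim (Filter.eventually_atTop.2 ⟨max 1 r, fun R hR => key R hR⟩)
  have habs : |η x₀| ≤ 0 := by
    by_contra h
    exact absurd hle (not_le.2 (mul_pos hI0 (not_le.1 h)))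
  exact abs_nonpos_iff.1 habs

/-- **Liouville in `BMO⁻¹`.** Let `w = div Φ` weakly (`HasWeakDivergenceRepresentation w Φ`:
`w`, `Φ` locally integrable and `∫ w θ = -∫ ⟪Φ, ∇θ⟫` for test functions `θ`) with every component
`⟪Φ, v⟫` in `BMO`, i.e. `w ∈ BMO⁻¹` in the divergence form of Koch–Tataru's Theorem 1, and let
`w` be weakly harmonic: `∫ Δθ · w = 0` for all `θ ∈ C_c^∞(E)`. Then `w = 0` a.e. — the
uniqueness statement "a harmonic distribution vanishing at infinity is zero" of
Lemarié-Rieusset 2016, Def. 6.4 (p. 130), for the class `BMO⁻¹`. Proof: the mollifications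
`φ_k ⋆ w` are harmonic (`laplacian_convolution_lsmul` and weak harmonicity), hence zero by
`convolution_eq_zero_of_harmonic_of_hasWeakDivergenceRepresentation`, and converge to `w` a.e.
[cite: LemarieRieusset2016, Def. 6.4 and the uniqueness remark p. 130] -/
theorem _root_.Literature.Analysis.FunctionSpaces.HasWeakDivergenceRepresentation.ae_eq_zero_of_weaklyHarmonic
    {w : E → ℝ} {Φ : E → E} (hrep : FunctionSpaces.HasWeakDivergenceRepresentation w Φ)
    (hΦ : ∀ v : E, FunctionSpaces.MemBMO (fun x => ⟪Φ x, v⟫))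
    (hharm : ∀ θ : E → ℝ, FunctionSpaces.IsTestFunctionOn (⊤ : Opens E) θ → ∫ x, (Δ θ) x * w x = 0) :
    w =ᵐ[volume] 0 := by
  have hwl : LocallyIntegrable w volume := hrep.locallyIntegrable
  obtain ⟨φ, hφ0, hφ2⟩ := FunctionSpaces.exists_contDiffBump_seq (E := E)
  -- every mollification is harmonic, hence zero
  have hzero : ∀ (k : ℕ) (x : E), ((φ k).normed volume ⋆[lsmul ℝ ℝ, volume] w) x = 0 := by
    intro k
    set ψ : E → ℝ := (φ k).normed volume with hψ_def
    have hψ : FunctionSpaces.IsTestFunctionOn (⊤ : Opens E) ψ := FunctionSpaces.isTestFunctionOn_normed (φ k)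
    have hψ2 : ContDiff ℝ 2 ψ := contDiff_infty.1 hψ.contDiff 2
    have hh2 : ContDiff ℝ 2 (ψ ⋆[lsmul ℝ ℝ, volume] w) :=
      hψ.hasCompactSupport.contDiff_convolution_left _ hψ2 hwl
    have hΔ : ∀ x, Δ (ψ ⋆[lsmul ℝ ℝ, volume] w) x = 0 := by
      intro x
      rw [laplacian_convolution_lsmul hψ2 hψ.hasCompactSupport hwl x, convolution_def]
      simp only [lsmul_apply, smul_eq_mul]
      have e := integral_sub_left_eq_self (fun t => (Δ ψ) t * w (x - t)) volume x
      simp only [sub_sub_cancel] at e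
      rw [← e]
      have hθ : FunctionSpaces.IsTestFunctionOn (⊤ : Opens E) (fun z => ψ (x - z)) := hψ.comp_sub_left x
      have key := hharm _ hθ
      simp_rw [laplacian_comp_sub_left hψ2 x] at key
      exact key
    have hharm' : HarmonicOnNhd (ψ ⋆[lsmul ℝ ℝ, volume] w) univ := fun x _ =>
      ⟨hh2.contDiffAt, Eventually.of_forall fun y => hΔ y⟩
    exact convolution_eq_zero_of_harmonic_of_hasWeakDivergenceRepresentation hrep hΦ hψ
      (fun x => (φ k).nonneg_normed x) (φ k).integral_normed hharm'
  -- the mollifications converge to `w` a.e.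
  have hlim := FunctionSpaces.ae_tendsto_normed_convolution hφ0 hφ2 hwl
  filter_upwards [hlim] with x hx
  simp_rw [hzero] at hx
  exact (tendsto_nhds_unique tendsto_const_nhds hx).symm

end Liouville

/-! ### The annihilator lemma in `BMO⁻¹` -/

section Annihilator

/-- A field all of whose components are locally integrable is locally integrable. [folklore] -/
theorem locallyIntegrable_of_inner {h : E → E}
    (hc : ∀ v : E, LocallyIntegrable (fun x => ⟪h x, v⟫) volume) : LocallyIntegrable h volume := by
  set e := stdOrthonormalBasis ℝ E
  have heq : h = fun x => ∑ i, ⟪h x, e i⟫ • e i := by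
    funext x
    conv_lhs => rw [← e.sum_repr' (h x)]
    exact Finset.sum_congr rfl fun i _ => by rw [real_inner_comm]
  rw [heq]
  refine locallyIntegrable_finsetSum _ fun i _ => ?_
  refine ((hc (e i)).smul (‖e i‖ : ℝ)).mono ((hc (e i)).aestronglyMeasurable.smul_const _)
    (Eventually.of_forall fun x => le_of_eq ?_)
  simp [norm_smul, mul_comm]

/-- **Annihilator lemma in `BMO⁻¹` (a `BMO⁻¹` field which is weakly solenoidal and weakly
irrotational vanishes), PROVED.** Let `E` be a finite-dimensional real inner product space with
its Lebesgue measure. If `h : E → E` lies in `BMO⁻¹(E; E)` (`MemBMOInvVec`: every component is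
the weak divergence of a field with `BMO` components), is weakly divergence free, and
`∫ ⟪h, φ⟫ = 0` for every `φ ∈ C_c^∞(E; E)` with `div φ = 0`, then `h = 0` a.e. The components
`⟪h, eᵢ⟫` are weakly harmonic (`integral_laplacian_mul_inner_eq_zero`: the weak form of
`ΔF = ∇div F - curl curl F`) and lie in `BMO⁻¹`, so Liouville in `BMO⁻¹` applies. This is what
turns the duality-form initial condition of a Koch–Tataru solution (`∫ ⟪v(0) - u₀, φ⟫ = 0` for
solenoidal `φ`) into `v(0) = u₀` a.e. (Koch–Tataru 2001, Theorem 2: the solution takes its datum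
in `BMO⁻¹`; Lemarié-Rieusset 2016, Def. 6.4). [cite: LemarieRieusset2016, Def. 6.4 and the uniqueness remark p. 130] -/
theorem IsWeaklyDivFree.ae_eq_zero_of_memBMOInvVec_of_forall_integral_inner_eq_zero
    {h : E → E} (hBMO : FunctionSpaces.MemBMOInvVec h) (hdiv : IsWeaklyDivFree h)
    (horth : ∀ φ : E → E, FunctionSpaces.IsTestFunctionOn (⊤ : Opens E) φ → VectorCalculus.IsDivFree φ →
      ∫ x, ⟪h x, φ x⟫ = 0) :
    h =ᵐ[volume] 0 := by
  set e := stdOrthonormalBasis ℝ E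
  have hcl : ∀ v : E, LocallyIntegrable (fun x => ⟪h x, v⟫) volume := fun v => by
    obtain ⟨Φ, -, hrep⟩ := hBMO v
    exact hrep.locallyIntegrable
  have hl : LocallyIntegrable h volume := locallyIntegrable_of_inner hcl
  have hci : ∀ i, (fun x => ⟪h x, e i⟫) =ᵐ[volume] 0 := fun i => by
    obtain ⟨Φ, hΦ, hrep⟩ := hBMO (e i)
    exact hrep.ae_eq_zero_of_weaklyHarmonic hΦ fun θ hθ =>
      integral_laplacian_mul_inner_eq_zero hl hdiv horth hθ (e i)
  have hall : ∀ᵐ x ∂(volume : Measure E), ∀ i, ⟪h x, e i⟫ = 0 :=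
    ae_all_iff.2 fun i => (hci i).mono fun x hx => hx
  filter_upwards [hall] with x hx
  rw [Pi.zero_apply, ← e.sum_repr' (h x)]
  exact Finset.sum_eq_zero fun i _ => by rw [real_inner_comm, hx i, zero_smul]

end Annihilator


end Literature.Analysis.FluidPDE
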